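import Summits.QuantumFields.YangMills.Theorems.BalabanUVNodesN11NodeFacesOfSupplyChainTokensAtZWitness
import Literature.MathematicalPhysics.QuantumFieldTheory.Balaban1983to89.Node00.Record13NumericsOfThm1CCMWZB

/-!
# DAG node N11 — THE STEP-WINDOW TOKEN SOCKETS AT THE εbg-LETTER z-WITNESS `θ₁₅ᶜᶜᴹᵂᶻᴮ(j; γ; εbg; Efl, logz) = theta13OfThm1CCMWZB …` (DEF-1's Z3) AND AT ITS CERTIFICATE
# `θᴳᶻᴮ := gaussPinH (ofHistoryBlind ⟨θ₁₅ᶜᶜᴹᵂᶻᴮ, Zr⟩)` — the Z3 TWIN of dag-n11-w1's `…N11NodeFacesOfSupplyChainTokensAtZWitness` §2–§3 (its `εbg = 1` member, §4 `rfl`)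

Cell `pub-ymgap` (D-0062 Track A), seat `pub-ymgap-dag-n24-c` (R134 N24 [B2 composite] s2, gen 16) for the K0-AT-Z3 road (plan g91 SIZING WORD I.46176: L1 p706279 ✓ · L2 · L3 · L4 = V22-Z):
item (Z-5) of this seat's LOCATED-ZB-DEPS census (I.46522) — the K1 engine of record (p683697) reads `h11Family_gaussPinH_ofHistoryBlind_theta13OfThm1CCMWZ_of_operandRows_windowed`;
a V22-Z face needs it AT THE Z3 MEMBER `εbg := a₀`.  First refusal offered to the dag-n11-w1 lineage (I.46522).  Key K1⁹ = stmt-QuantumFields-27364 (`--kind proof --supports 27364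
--as helper`; count-neutral).  [III] = [Balaban1988Convergent]; [V] = [Balaban1989LargeFieldII]; [IV] = [Balaban1989LargeFieldI]; [I] = [Balaban1987RG1].

WHAT.  A TOKEN-PASS of dag-n11-w1's §2–§3 (`theta13OfThm1CCMWZ … ↦ theta13OfThm1CCMWZB … εbg …`, `stage12NumericsOfThm1CCMW ↦ stage12NumericsOfThm1CCMWB … εbg …` with THE ONE NEW SIGN
`0 < εbg` (Z3 `stage12NumericsOfThm1CCMWB_pos_of_le_half`), `M = L^j ≥ 1` inline; every composition VERBATIM through dag-n11-w1's θ-GENERIC §1 sockets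
`b14_main_leavesP_all_∕thm1Printed_datumOfRecord₁₃CoPH_∕h11Family_theta13LiveOfNumericsZH_of_supplyChainAt_family`, imported BY NAME — `θ₁₅ᶜᶜᴹᵂᶻᴮ` IS the member of DEF-1's live
family `theta13LiveOfNumericsZ` at the B numerics, `rfl`): §2 `b14_main_leavesP_all_∕thm1Printed_datumOfRecord₁₃CoPH_∕h11Family_theta13OfThm1CCMWZBH_of_supplyChainAt_family`; §3 at the
certificate `θᴳᶻᴮ`: ★★★ `h11Family_gaussPinH_ofHistoryBlind_theta13OfThm1CCMWZB_of_supplyChainAt_family` · `…_of_continuous` · `b14_main_leavesP_all_gaussPinH_ofHistoryBlind_theta13OfThm1CCMWZB_of_continuous` ·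
★★★ `h11Family_gaussPinH_ofHistoryBlind_theta13OfThm1CCMWZB_of_operandRows_windowed`; §4 `gaussPinH_ofHistoryBlind_theta13OfThm1CCMWZ_eq_B_one` (`rfl`).

HONEST FRAMING.  Helper lane of K1⁹; count-neutral KERNEL COMPOSITION of landed θ-generic theorems at DEF-1's Z3 definition edition; `SupplierObligations` ([III] §3 ∕ Thm 2 proper —
XL, nobody's theorem), the continuity∕bound rows, def-T's operand rows, the certificate door `hG`∕`hrec` are DISPLAYED HYPOTHESES; NO value of `εbg`, `E_k`, `log z_k` pinned or read;
NOT a claim that any Z3 member is K1⁹'s witness; K0⁷ V21-G texts untouched (V22-Z is the plan's ∕ k0 lanes'); nothing of Bałaban asserted; K1⁹ NOT closed; N11 NOT discharged (FLAG №1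
open); counts unmoved (typed 28∕28 · discharged 8∕28, 8∕27 excl. NODE O).  One finite `𝕋⁴_{L^K}` programme at fixed `ε = L^{−K}`; R4 closes only the conditional finite-𝕋⁴ rung
`BalabanLadder.UV` — NOT ℝ⁴, NOT OS, NOT a mass gap, NOT Clay.  No `sorry`, `axiom`, `def`, `instance`, `notation`.
Sources (SHAPE ∕ bookkeeping only): [III] Thm 1 p.262, Theorem p.245, remark p.262, p.244 L36–38, §3 p.279, (1.15) p.249, (2.4) p.255, (2.10) p.256, (3.16)–(3.25) pp.268–270;
[V] Thm 1 + (0.1) pp.355–356, (0.15) p.360; [IV] (0.3)–(0.4) p.176, p.177 (i)–(ii); [I] Thm 1 p.259, (0.20)–(0.21) p.256.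
-/

noncomputable section

open MeasureTheory TopologicalSpace
open scoped BigOperators ENNReal NNReal Matrix.Norms.L2Operator

namespace Summit.QuantumFields.YangMills.Theorems.BalabanUVNodesN11NodeFacesOfSupplyChainTokensAtZBWitness

open Literature.MathematicalPhysics.QuantumFieldTheory.Balaban1983to89 T4Continuum T4NestedCovariance Node00 Node00.Tk DagBinding
open B15DeterminingSets B8Eq17ClassAkV1 B14.Eq218Concrete B10Eq42TorusConstraint Step
open BalabanUVNodesN11HistoryPinnedResidualDefs BalabanUVNodesN11RePinnedParamDefs
open BalabanUVNodesN11GaussianCertificateDefs (gaussPinH gaussPinH_ζ0 gaussPinH_quad provisos₁₃CoPH_gaussPinH)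
open BalabanUVNodesN11Sect3SupplyChainDefs
open BalabanUVNodesN11Sect3SupplyChainObligationsDefs
open BalabanUVNodesN11NodeFacesOfSupplyChainTokens
open BalabanUVNodesN11NodeFacesOfSupplyChainTokensAtWitness
open BalabanUVNodesN11NodeFacesOfSupplyChainTokensOperandRoads (supplyChainAt_family_of_gaussCert_of_operandRows)
open BalabanUVNodesN11NodeFacesOfSupplyChainTokensAtZWitness
  (b14_main_leavesP_all_theta13LiveOfNumericsZH_of_supplyChainAt_family thm1Printed_datumOfRecord₁₃CoPH_theta13LiveOfNumericsZH_of_supplyChainAt_family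
    h11Family_theta13LiveOfNumericsZH_of_supplyChainAt_family)

variable {F : T4Family} {N : ℕ} [NeZero N]

/-! ## §2  At the εbg-letter z-witness `θ₁₅ᶜᶜᴹᵂᶻᴮ(j; γ; εbg; Efl, logz) = theta13OfThm1CCMWZB F N j γ εbg ε₀ ε₂₉ B₃ B₃' a₀ a₁ Efl logz`: the window `0 < γ ≤ ½` and the six signs ONLY -/

section K1WitnessZ

variable {j : ℕ} {γ εbg ε₀ ε₂₉ B₃ B₃' a₀ a₁ : ℝ} {Efl logz : B12.RunParams → ℕ → ℝ} {θ : Stage13HParams F N}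

/-- **★ N11's DAG NODE AT EVERY RUN AT ANY H-EXTENSION OF THE z-WITNESS `θ₁₅ᶜᶜᴹᵂᶻ(j; γ; Efl, logz)` FROM A FAMILY OF TOKENS ON THE STEP WINDOW `]0, γ′]`** — world bound to the
CoPH datum (`hrec` the key), `w.γ ≤ γ′`; window `0 < γ ≤ ½` + six signs (`stage12NumericsOfThm1CCMW_pos_of_le_half`; numerals `κ = 2·10⁴`, `E₀ = B₀ = 1`, `M = L^j ≥ 1`); the
letters `Efl`, `logz` are NOT read. [cite: Balaban1988Convergent, Thm 1 p.262, Theorem p.245, p.244 L36–38, §3 p.279, (1.15) p.249, (2.4) p.255, (2.10) p.256; Balaban1987RG1, Thm 1 p.259; Balaban1989LargeFieldII, (0.15) p.360; Balaban1989LargeFieldI, (0.3)–(0.4) p.176, p.177 (i)–(ii)] -/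
theorem b14_main_leavesP_all_theta13OfThm1CCMWZBH_of_supplyChainAt_family (hθ : θ.toStage13Params = theta13OfThm1CCMWZB F N j γ εbg ε₀ ε₂₉ B₃ B₃' a₀ a₁ Efl logz)
    (hγ₀ : 0 < γ) (hγh : γ ≤ 1 / 2) (hbg : 0 < εbg) (hε : 0 < ε₀) (hε' : 0 < ε₂₉) (hB : 0 ≤ B₃) (hB' : 0 ≤ B₃') (ha₀ : 0 < a₀) (ha₁ : 0 < a₁) (hrec : θ.Provisos₁₃CoPH F N)
    {γ' : ℝ} (hN : ∀ P : B12.RunParams, Step.InInterval γ' P.K (gOfRecord₁₃ F N θ.toStage13Params P) → SupplyChainAt θ P)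
    (w : WorldP) (hC : w.C = (datumOfRecord₁₃CoPH F N θ hrec).C) (hγw : w.γ ≤ γ') : ∀ P : B12.RunParams, Dag.B14_main (leavesP w P) :=
  b14_main_leavesP_all_theta13LiveOfNumericsZH_of_supplyChainAt_family hθ (stage12NumericsOfThm1CCMWB_pos_of_le_half F.hL.2.le hγ₀ hγh hbg hε hB hB' ha₀ ha₁) hε'
    (by rw [show (stage12NumericsOfThm1CCMWB F.L j γ εbg ε₀ B₃ B₃' a₀ a₁).s2.lf.κ = 20000 from rfl]; norm_num)
    (by rw [show (stage12NumericsOfThm1CCMWB F.L j γ εbg ε₀ B₃ B₃' a₀ a₁).s2.lf.E₀ = 1 from rfl]; norm_num)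
    (by rw [show (stage12NumericsOfThm1CCMWB F.L j γ εbg ε₀ B₃ B₃' a₀ a₁).s2.lf.B₀ = 1 from rfl]; norm_num)
    (by show 1 ≤ F.L ^ j; exact Nat.one_le_pow _ _ (by have := F.hL11; omega)) hrec hN w hC hγw

/-- **★ `B16.Thm1Printed` AT THE CoPH DATUM OF ANY H-EXTENSION OF `θ₁₅ᶜᶜᴹᵂᶻ(j; γ; Efl, logz)` FROM A FAMILY OF TOKENS ON THE STEP WINDOW `]0, γ′]`, `0 < γ′`** (window `0 < γ ≤ ½`
+ six signs). [cite: Balaban1988Convergent, Thm 1 p.262, Theorem p.245, p.244 L36–38, §3 p.279, (1.15) p.249; Balaban1989LargeFieldII, Thm 1 p.355, (0.15) p.360; Balaban1987RG1, Thm 1 p.259; Balaban1989LargeFieldI, (0.3)–(0.4) p.176] -/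
theorem thm1Printed_datumOfRecord₁₃CoPH_theta13OfThm1CCMWZBH_of_supplyChainAt_family (hθ : θ.toStage13Params = theta13OfThm1CCMWZB F N j γ εbg ε₀ ε₂₉ B₃ B₃' a₀ a₁ Efl logz)
    (hγ₀ : 0 < γ) (hγh : γ ≤ 1 / 2) (hbg : 0 < εbg) (hε : 0 < ε₀) (hε' : 0 < ε₂₉) (hB : 0 ≤ B₃) (hB' : 0 ≤ B₃') (ha₀ : 0 < a₀) (ha₁ : 0 < a₁) (hrec : θ.Provisos₁₃CoPH F N)
    {γ' : ℝ} (hγ' : 0 < γ') (hN : ∀ P : B12.RunParams, Step.InInterval γ' P.K (gOfRecord₁₃ F N θ.toStage13Params P) → SupplyChainAt θ P) :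
    B16.Thm1Printed (datumOfRecord₁₃CoPH F N θ hrec).C :=
  thm1Printed_datumOfRecord₁₃CoPH_theta13LiveOfNumericsZH_of_supplyChainAt_family hθ (stage12NumericsOfThm1CCMWB_pos_of_le_half F.hL.2.le hγ₀ hγh hbg hε hB hB' ha₀ ha₁) hε'
    (by rw [show (stage12NumericsOfThm1CCMWB F.L j γ εbg ε₀ B₃ B₃' a₀ a₁).s2.lf.κ = 20000 from rfl]; norm_num)
    (by rw [show (stage12NumericsOfThm1CCMWB F.L j γ εbg ε₀ B₃ B₃' a₀ a₁).s2.lf.E₀ = 1 from rfl]; norm_num)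
    (by rw [show (stage12NumericsOfThm1CCMWB F.L j γ εbg ε₀ B₃ B₃' a₀ a₁).s2.lf.B₀ = 1 from rfl]; norm_num)
    (by show 1 ≤ F.L ^ j; exact Nat.one_le_pow _ _ (by have := F.hL11; omega)) hrec hγ' hN

/-- **★★ THE `h11`-SHAPED FAMILY AT THE SepCoPH DATUM OF ANY H-EXTENSION OF `θ₁₅ᶜᶜᴹᵂᶻ(j; γ; Efl, logz)` FROM A FAMILY OF TOKENS ON THE STEP WINDOW `]0, γ′]`, `0 < γ′`**
(`γ₁₁ := γ′`; window `0 < γ ≤ ½` + six signs; only `smallCouplings` read) — dag-n24-c's N11 child SHAPE at the z-witness. [cite: Balaban1988Convergent, Theorem p.245, Thm 1 p.262, remark p.262, p.244 L36–38, §3 p.279, (1.15) p.249; Balaban1989LargeFieldII, Thm 1 + (0.1) pp.355–356, (0.15) p.360; Balaban1987RG1, Thm 1 p.259; Balaban1989LargeFieldI, (0.3)–(0.4) p.176] -/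
theorem h11Family_theta13OfThm1CCMWZBH_of_supplyChainAt_family (hθ : θ.toStage13Params = theta13OfThm1CCMWZB F N j γ εbg ε₀ ε₂₉ B₃ B₃' a₀ a₁ Efl logz)
    (hγ₀ : 0 < γ) (hγh : γ ≤ 1 / 2) (hbg : 0 < εbg) (hε : 0 < ε₀) (hε' : 0 < ε₂₉) (hB : 0 ≤ B₃) (hB' : 0 ≤ B₃') (ha₀ : 0 < a₀) (ha₁ : 0 < a₁) (hrec : θ.Provisos₁₃SepCoPH F N)
    {γ' : ℝ} (hγ' : 0 < γ') (hN : ∀ P : B12.RunParams, Step.InInterval γ' P.K (gOfRecord₁₃ F N θ.toStage13Params P) → SupplyChainAt θ P) :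
    ∀ βup β₀ : ℝ, ∃ γ₁₁ : ℝ, 0 < γ₁₁ ∧ ∀ w : WorldP, w.C = (datumOfRecord₁₃SepCoPH F N θ hrec).C → w.βup = βup → w.β₀ = β₀ → w.γ ≤ γ₁₁ →
      ∀ P : B12.RunParams, (leavesP w P).b7 → (leavesP w P).b8 → (leavesP w P).b9 → (leavesP w P).b10 → (leavesP w P).b11 →
      (leavesP w P).smallCouplings → (leavesP w P).smallFieldInductive → (leavesP w P).flowControl →
        ∀ k, k < P.K → SLaw₁₃CoPH F N θ P k → TLaw₁₃CoPH F N θ P k :=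
  h11Family_theta13LiveOfNumericsZH_of_supplyChainAt_family hθ (stage12NumericsOfThm1CCMWB_pos_of_le_half F.hL.2.le hγ₀ hγh hbg hε hB hB' ha₀ ha₁) hε'
    (by rw [show (stage12NumericsOfThm1CCMWB F.L j γ εbg ε₀ B₃ B₃' a₀ a₁).s2.lf.κ = 20000 from rfl]; norm_num)
    (by rw [show (stage12NumericsOfThm1CCMWB F.L j γ εbg ε₀ B₃ B₃' a₀ a₁).s2.lf.E₀ = 1 from rfl]; norm_num)
    (by rw [show (stage12NumericsOfThm1CCMWB F.L j γ εbg ε₀ B₃ B₃' a₀ a₁).s2.lf.B₀ = 1 from rfl]; norm_num)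
    (by show 1 ≤ F.L ^ j; exact Nat.one_le_pow _ _ (by have := F.hL11; omega)) hrec hγ' hN

end K1WitnessZ

/-! ## §3  At the certificate `θᴳᶻ := gaussPinH (Stage13HParams.ofHistoryBlind F N ⟨θ₁₅ᶜᶜᴹᵂᶻ, Zr⟩)` of the z-witness: the `h11` child from the windowed token family; the
CONTINUITY-road and OPERAND-ROWS-road editions; N11's node on the continuity road (`θᴳᶻ.toStage13Params = θ₁₅ᶜᶜᴹᵂᶻ`, `rfl`) -/

section CertificateZ

variable {j : ℕ} {γ εbg ε₀ ε₂₉ B₃ B₃' a₀ a₁ : ℝ} {Efl logz : B12.RunParams → ℕ → ℝ} (Zr : (q : B12.RunParams) → TkResidualW F N (FluctV N) q.K)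

/-- **★★★ N11's CHILD FAMILY IN dag-n24-c's `h11` SHAPE AT `θᴳᶻ`'s SepCoPH DATUM FROM A FAMILY OF TOKENS ON THE STEP WINDOW `]0, γ′]`, `0 < γ′`** (any door proof `hG` keys the
datum; `γ₁₁ := γ′`; window `0 < γ ≤ ½` + six signs; letters NOT read): the token asked on windowed runs only — what the supplier roads deliver. [cite: Balaban1988Convergent, Theorem p.245, Thm 1 p.262, remark p.262, p.244 L36–38, §3 p.279, (3.16) p.268, (1.15) p.249; Balaban1989LargeFieldII, Thm 1 + (0.1) pp.355–356, (0.15) p.360; Balaban1987RG1, Thm 1 p.259; Balaban1989LargeFieldI, (0.3)–(0.4) p.176] -/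
theorem h11Family_gaussPinH_ofHistoryBlind_theta13OfThm1CCMWZB_of_supplyChainAt_family (hγ₀ : 0 < γ) (hγh : γ ≤ 1 / 2) (hbg : 0 < εbg) (hε : 0 < ε₀) (hε' : 0 < ε₂₉)
    (hB : 0 ≤ B₃) (hB' : 0 ≤ B₃') (ha₀ : 0 < a₀) (ha₁ : 0 < a₁)
    (hG : (gaussPinH (Stage13HParams.ofHistoryBlind F N ⟨theta13OfThm1CCMWZB F N j γ εbg ε₀ ε₂₉ B₃ B₃' a₀ a₁ Efl logz, Zr⟩)).Provisos₁₃SepCoPH F N) {γ' : ℝ} (hγ' : 0 < γ')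
    (hN : ∀ P : B12.RunParams, Step.InInterval γ' P.K (gOfRecord₁₃ F N (theta13OfThm1CCMWZB F N j γ εbg ε₀ ε₂₉ B₃ B₃' a₀ a₁ Efl logz) P) →
      SupplyChainAt (gaussPinH (Stage13HParams.ofHistoryBlind F N ⟨theta13OfThm1CCMWZB F N j γ εbg ε₀ ε₂₉ B₃ B₃' a₀ a₁ Efl logz, Zr⟩)) P) :
    ∀ βup β₀ : ℝ, ∃ γ₁₁ : ℝ, 0 < γ₁₁ ∧ ∀ w : WorldP,
      w.C = (datumOfRecord₁₃SepCoPH F N (gaussPinH (Stage13HParams.ofHistoryBlind F N ⟨theta13OfThm1CCMWZB F N j γ εbg ε₀ ε₂₉ B₃ B₃' a₀ a₁ Efl logz, Zr⟩)) hG).C →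
      w.βup = βup → w.β₀ = β₀ → w.γ ≤ γ₁₁ → ∀ P : B12.RunParams, (leavesP w P).b7 → (leavesP w P).b8 → (leavesP w P).b9 → (leavesP w P).b10 → (leavesP w P).b11 →
      (leavesP w P).smallCouplings → (leavesP w P).smallFieldInductive → (leavesP w P).flowControl →
        ∀ k, k < P.K → SLaw₁₃CoPH F N (gaussPinH (Stage13HParams.ofHistoryBlind F N ⟨theta13OfThm1CCMWZB F N j γ εbg ε₀ ε₂₉ B₃ B₃' a₀ a₁ Efl logz, Zr⟩)) P k →
          TLaw₁₃CoPH F N (gaussPinH (Stage13HParams.ofHistoryBlind F N ⟨theta13OfThm1CCMWZB F N j γ εbg ε₀ ε₂₉ B₃ B₃' a₀ a₁ Efl logz, Zr⟩)) P k :=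
  h11Family_theta13OfThm1CCMWZBH_of_supplyChainAt_family (θ := gaussPinH (Stage13HParams.ofHistoryBlind F N ⟨theta13OfThm1CCMWZB F N j γ εbg ε₀ ε₂₉ B₃ B₃' a₀ a₁ Efl logz, Zr⟩))
    rfl hγ₀ hγh hbg hε hε' hB hB' ha₀ ha₁ hG hγ' hN

/-- **★★★ N11's CHILD FAMILY IN dag-n24-c's `h11` SHAPE AT `θᴳᶻ`'s SepCoPH DATUM ON THE CONTINUITY ROAD** — from, PER WINDOWED RUN (`Step.InInterval γ′ P.K (gOfRecord₁₃ θ₁₅ᶜᶜᴹᵂᶻ P)`,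
`0 < γ′`), [III] §3's supplier `σ P` at `θᴳᶻ` with `SupplierObligations` whose chain terms are CONTINUOUS in the configuration (resp. (configuration, fluctuation)) with the two displayed
real-part BOUNDS (this seat's G rows), the door key `hG` — NOTHING ELSE: no `cR`, no K0 row, no bg fact, no run guard, no operand row; window `0 < γ ≤ ½` + six signs; letters NOT
read; `γ₁₁ := γ′`.  THE HONEST STATE of N11's K1-road child at the z-witness certificate on the continuity road: the ONE displayed analytic binder is [III] §3's supplier with its
obligations and continuous bounded terms (Thm 2 proper — XL, nobody's theorem). [cite: Balaban1988Convergent, Theorem p.245, Thm 1 p.262, remark p.262, p.244 L36–38, §3 p.279, (3.16)–(3.21) pp.268–269, (3.23)–(3.25) p.270, (1.15) p.249; Balaban1989LargeFieldII, Thm 1 + (0.1) pp.355–356, (0.15) p.360; Balaban1987RG1, Thm 1 p.259; Balaban1989LargeFieldI, (0.3)–(0.4) p.176, p.177 (i)–(ii)] -/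
theorem h11Family_gaussPinH_ofHistoryBlind_theta13OfThm1CCMWZB_of_continuous (hγ₀ : 0 < γ) (hγh : γ ≤ 1 / 2) (hbg : 0 < εbg) (hε : 0 < ε₀) (hε' : 0 < ε₂₉)
    (hB : 0 ≤ B₃) (hB' : 0 ≤ B₃') (ha₀ : 0 < a₀) (ha₁ : 0 < a₁)
    (hG : (gaussPinH (Stage13HParams.ofHistoryBlind F N ⟨theta13OfThm1CCMWZB F N j γ εbg ε₀ ε₂₉ B₃ B₃' a₀ a₁ Efl logz, Zr⟩)).Provisos₁₃SepCoPH F N) {γ' : ℝ} (hγ' : 0 < γ')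
    (σ : (P : B12.RunParams) → Sect3Supplier (gaussPinH (Stage13HParams.ofHistoryBlind F N ⟨theta13OfThm1CCMWZB F N j γ εbg ε₀ ε₂₉ B₃ B₃' a₀ a₁ Efl logz, Zr⟩)) P)
    (hσ : ∀ P : B12.RunParams, Step.InInterval γ' P.K (gOfRecord₁₃ F N (theta13OfThm1CCMWZB F N j γ εbg ε₀ ε₂₉ B₃ B₃' a₀ a₁ Efl logz) P) →
      SupplierObligations (gaussPinH (Stage13HParams.ofHistoryBlind F N ⟨theta13OfThm1CCMWZB F N j γ εbg ε₀ ε₂₉ B₃ B₃' a₀ a₁ Efl logz, Zr⟩)) P (σ P))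
    (hE : ∀ P : B12.RunParams, Step.InInterval γ' P.K (gOfRecord₁₃ F N (theta13OfThm1CCMWZB F N j γ εbg ε₀ ε₂₉ B₃ B₃' a₀ a₁ Efl logz) P) →
      ∀ (k : ℕ) (s : SeqOfRecord F (theta13OfThm1CCMWZB F N j γ εbg ε₀ ε₂₉ B₃ B₃' a₀ a₁ Efl logz).ν (theta13OfThm1CCMWZB F N j γ εbg ε₀ ε₂₉ B₃ B₃' a₀ a₁ Efl logz).τ9.M
        (gOfRecord₁₃ F N (theta13OfThm1CCMWZB F N j γ εbg ε₀ ε₂₉ B₃ B₃' a₀ a₁ Efl logz) P) P.K (k + 1)) (i : ℕ), 1 ≤ i →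
      ∀ (X : (Sect2.domSys (F.P P.K) (theta13OfThm1CCMWZB F N j γ εbg ε₀ ε₂₉ B₃ B₃' a₀ a₁ Efl logz).τ9.M i).Dom) (z : Site (F.P P.K) i) (g' : ℝ),
      Continuous (fun U : GaugeField (F.P P.K) 0 (SU N) =>
        ((σ P k (chainWitness _ P (σ P) k).1 (chainWitness _ P (σ P) k).2).1 s).E i X z g'
          (Sect2.ofBackgroundC (settingOfRecord₁₃ F N (theta13OfThm1CCMWZB F N j γ εbg ε₀ ε₂₉ B₃ B₃' a₀ a₁ Efl logz) P).ι U)))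
    (hCE : ∀ P : B12.RunParams, Step.InInterval γ' P.K (gOfRecord₁₃ F N (theta13OfThm1CCMWZB F N j γ εbg ε₀ ε₂₉ B₃ B₃' a₀ a₁ Efl logz) P) →
      ∀ (k : ℕ) (s : SeqOfRecord F (theta13OfThm1CCMWZB F N j γ εbg ε₀ ε₂₉ B₃ B₃' a₀ a₁ Efl logz).ν (theta13OfThm1CCMWZB F N j γ εbg ε₀ ε₂₉ B₃ B₃' a₀ a₁ Efl logz).τ9.M
        (gOfRecord₁₃ F N (theta13OfThm1CCMWZB F N j γ εbg ε₀ ε₂₉ B₃ B₃' a₀ a₁ Efl logz) P) P.K (k + 1)) (i : ℕ), 1 ≤ i → ∃ CE : ℝ,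
      ∀ (X : (Sect2.domSys (F.P P.K) (theta13OfThm1CCMWZB F N j γ εbg ε₀ ε₂₉ B₃ B₃' a₀ a₁ Efl logz).τ9.M i).Dom) (z : Site (F.P P.K) i) (g' : ℝ) (U : GaugeField (F.P P.K) 0 (SU N)),
      |(((σ P k (chainWitness _ P (σ P) k).1 (chainWitness _ P (σ P) k).2).1 s).E i X z g'
          (Sect2.ofBackgroundC (settingOfRecord₁₃ F N (theta13OfThm1CCMWZB F N j γ εbg ε₀ ε₂₉ B₃ B₃' a₀ a₁ Efl logz) P).ι U)).re| ≤ CE)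
    (hR : ∀ P : B12.RunParams, Step.InInterval γ' P.K (gOfRecord₁₃ F N (theta13OfThm1CCMWZB F N j γ εbg ε₀ ε₂₉ B₃ B₃' a₀ a₁ Efl logz) P) →
      ∀ (k : ℕ) (s : SeqOfRecord F (theta13OfThm1CCMWZB F N j γ εbg ε₀ ε₂₉ B₃ B₃' a₀ a₁ Efl logz).ν (theta13OfThm1CCMWZB F N j γ εbg ε₀ ε₂₉ B₃ B₃' a₀ a₁ Efl logz).τ9.M
        (gOfRecord₁₃ F N (theta13OfThm1CCMWZB F N j γ εbg ε₀ ε₂₉ B₃ B₃' a₀ a₁ Efl logz) P) P.K (k + 1)) (i : ℕ), 1 ≤ i →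
      ∀ X : (Sect2.domSys (F.P P.K) (theta13OfThm1CCMWZB F N j γ εbg ε₀ ε₂₉ B₃ B₃' a₀ a₁ Efl logz).τ9.M i).Dom,
      Continuous (fun U : GaugeField (F.P P.K) 0 (SU N) =>
        ((σ P k (chainWitness _ P (σ P) k).1 (chainWitness _ P (σ P) k).2).1 s).R i X
          (Sect2.ofBackgroundC (settingOfRecord₁₃ F N (theta13OfThm1CCMWZB F N j γ εbg ε₀ ε₂₉ B₃ B₃' a₀ a₁ Efl logz) P).ι U)))
    (hB9 : ∀ P : B12.RunParams, Step.InInterval γ' P.K (gOfRecord₁₃ F N (theta13OfThm1CCMWZB F N j γ εbg ε₀ ε₂₉ B₃ B₃' a₀ a₁ Efl logz) P) →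
      ∀ (k : ℕ) (s : SeqOfRecord F (theta13OfThm1CCMWZB F N j γ εbg ε₀ ε₂₉ B₃ B₃' a₀ a₁ Efl logz).ν (theta13OfThm1CCMWZB F N j γ εbg ε₀ ε₂₉ B₃ B₃' a₀ a₁ Efl logz).τ9.M
        (gOfRecord₁₃ F N (theta13OfThm1CCMWZB F N j γ εbg ε₀ ε₂₉ B₃ B₃' a₀ a₁ Efl logz) P) P.K (k + 1)) (S' : ℕ → Set (Site (F.P P.K) 0)) (i : ℕ)
        (X : (Sect2.domSys (F.P P.K) (theta13OfThm1CCMWZB F N j γ εbg ε₀ ε₂₉ B₃ B₃' a₀ a₁ Efl logz).τ9.M i).Dom),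
      Continuous (fun q : GaugeField (F.P P.K) 0 (SU N) × MSFluct (F.P P.K) (FluctV N) =>
        ((σ P k (chainWitness _ P (σ P) k).1 (chainWitness _ P (σ P) k).2).1 s).B i X
          (Sect2.ofBackgroundC (settingOfRecord₁₃ F N (theta13OfThm1CCMWZB F N j γ εbg ε₀ ε₂₉ B₃ B₃' a₀ a₁ Efl logz) P).ι q.1) (S', q.2)))
    (hCB : ∀ P : B12.RunParams, Step.InInterval γ' P.K (gOfRecord₁₃ F N (theta13OfThm1CCMWZB F N j γ εbg ε₀ ε₂₉ B₃ B₃' a₀ a₁ Efl logz) P) →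
      ∀ (k : ℕ) (s : SeqOfRecord F (theta13OfThm1CCMWZB F N j γ εbg ε₀ ε₂₉ B₃ B₃' a₀ a₁ Efl logz).ν (theta13OfThm1CCMWZB F N j γ εbg ε₀ ε₂₉ B₃ B₃' a₀ a₁ Efl logz).τ9.M
        (gOfRecord₁₃ F N (theta13OfThm1CCMWZB F N j γ εbg ε₀ ε₂₉ B₃ B₃' a₀ a₁ Efl logz) P) P.K (k + 1)) (i : ℕ), 1 ≤ i → ∃ CB : ℝ,
      ∀ (X : (Sect2.domSys (F.P P.K) (theta13OfThm1CCMWZB F N j γ εbg ε₀ ε₂₉ B₃ B₃' a₀ a₁ Efl logz).τ9.M i).Dom) (U : GaugeField (F.P P.K) 0 (SU N)) (a : Tk.SFluct (F.P P.K) (FluctV N)),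
      |(((σ P k (chainWitness _ P (σ P) k).1 (chainWitness _ P (σ P) k).2).1 s).B i X
          (Sect2.ofBackgroundC (settingOfRecord₁₃ F N (theta13OfThm1CCMWZB F N j γ εbg ε₀ ε₂₉ B₃ B₃' a₀ a₁ Efl logz) P).ι U) a).re| ≤ CB) :
    ∀ βup β₀ : ℝ, ∃ γ₁₁ : ℝ, 0 < γ₁₁ ∧ ∀ w : WorldP,
      w.C = (datumOfRecord₁₃SepCoPH F N (gaussPinH (Stage13HParams.ofHistoryBlind F N ⟨theta13OfThm1CCMWZB F N j γ εbg ε₀ ε₂₉ B₃ B₃' a₀ a₁ Efl logz, Zr⟩)) hG).C →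
      w.βup = βup → w.β₀ = β₀ → w.γ ≤ γ₁₁ → ∀ P : B12.RunParams, (leavesP w P).b7 → (leavesP w P).b8 → (leavesP w P).b9 → (leavesP w P).b10 → (leavesP w P).b11 →
      (leavesP w P).smallCouplings → (leavesP w P).smallFieldInductive → (leavesP w P).flowControl →
        ∀ k, k < P.K → SLaw₁₃CoPH F N (gaussPinH (Stage13HParams.ofHistoryBlind F N ⟨theta13OfThm1CCMWZB F N j γ εbg ε₀ ε₂₉ B₃ B₃' a₀ a₁ Efl logz, Zr⟩)) P k →
          TLaw₁₃CoPH F N (gaussPinH (Stage13HParams.ofHistoryBlind F N ⟨theta13OfThm1CCMWZB F N j γ εbg ε₀ ε₂₉ B₃ B₃' a₀ a₁ Efl logz, Zr⟩)) P k :=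
  h11Family_gaussPinH_ofHistoryBlind_theta13OfThm1CCMWZB_of_supplyChainAt_family Zr hγ₀ hγh hbg hε hε' hB hB' ha₀ ha₁ hG hγ'
    (supplyChainAt_family_of_gaussCert_of_continuous (gaussPinH (Stage13HParams.ofHistoryBlind F N ⟨theta13OfThm1CCMWZB F N j γ εbg ε₀ ε₂₉ B₃ B₃' a₀ a₁ Efl logz, Zr⟩))
      (gaussPinH_ζ0 _) (gaussPinH_quad _) hG.toCore (by show 1 ≤ F.L ^ j; exact Nat.one_le_pow _ _ (by have := F.hL11; omega)) σ hσ hE hCE hR hB9 hCB)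

/-- **★★ N11's DAG NODE AT EVERY RUN AT A WORLD BOUND TO `θᴳᶻ`'s CoPH DATUM ON THE CONTINUITY ROAD** (`w.γ ≤ γ′`; door core `hrec` keys the datum; window `0 < γ ≤ ½` + six signs;
letters NOT read): from, per windowed run, [III] §3's supplier at `θᴳᶻ` with `SupplierObligations` and continuous bounded terms — NOTHING ELSE displayed.  `βup ∕ β₀ ∕ b ∕ gR ∕ up`
UNREAD. [cite: Balaban1988Convergent, Thm 1 p.262, Theorem p.245, p.244 L36–38, §3 p.279, (3.16)–(3.21) pp.268–269, (3.23)–(3.25) p.270, (1.15) p.249; Balaban1989LargeFieldII, Introduction pp.355–356, (0.15) p.360; Balaban1987RG1, Thm 1 p.259; Balaban1989LargeFieldI, (0.3)–(0.4) p.176, p.177 (i)–(ii)] -/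
theorem b14_main_leavesP_all_gaussPinH_ofHistoryBlind_theta13OfThm1CCMWZB_of_continuous (hγ₀ : 0 < γ) (hγh : γ ≤ 1 / 2) (hbg : 0 < εbg) (hε : 0 < ε₀) (hε' : 0 < ε₂₉)
    (hB : 0 ≤ B₃) (hB' : 0 ≤ B₃') (ha₀ : 0 < a₀) (ha₁ : 0 < a₁)
    (hrec : (gaussPinH (Stage13HParams.ofHistoryBlind F N ⟨theta13OfThm1CCMWZB F N j γ εbg ε₀ ε₂₉ B₃ B₃' a₀ a₁ Efl logz, Zr⟩)).Provisos₁₃CoPH F N) {γ' : ℝ}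
    (σ : (P : B12.RunParams) → Sect3Supplier (gaussPinH (Stage13HParams.ofHistoryBlind F N ⟨theta13OfThm1CCMWZB F N j γ εbg ε₀ ε₂₉ B₃ B₃' a₀ a₁ Efl logz, Zr⟩)) P)
    (hσ : ∀ P : B12.RunParams, Step.InInterval γ' P.K (gOfRecord₁₃ F N (theta13OfThm1CCMWZB F N j γ εbg ε₀ ε₂₉ B₃ B₃' a₀ a₁ Efl logz) P) →
      SupplierObligations (gaussPinH (Stage13HParams.ofHistoryBlind F N ⟨theta13OfThm1CCMWZB F N j γ εbg ε₀ ε₂₉ B₃ B₃' a₀ a₁ Efl logz, Zr⟩)) P (σ P))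
    (hE : ∀ P : B12.RunParams, Step.InInterval γ' P.K (gOfRecord₁₃ F N (theta13OfThm1CCMWZB F N j γ εbg ε₀ ε₂₉ B₃ B₃' a₀ a₁ Efl logz) P) →
      ∀ (k : ℕ) (s : SeqOfRecord F (theta13OfThm1CCMWZB F N j γ εbg ε₀ ε₂₉ B₃ B₃' a₀ a₁ Efl logz).ν (theta13OfThm1CCMWZB F N j γ εbg ε₀ ε₂₉ B₃ B₃' a₀ a₁ Efl logz).τ9.M
        (gOfRecord₁₃ F N (theta13OfThm1CCMWZB F N j γ εbg ε₀ ε₂₉ B₃ B₃' a₀ a₁ Efl logz) P) P.K (k + 1)) (i : ℕ), 1 ≤ i →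
      ∀ (X : (Sect2.domSys (F.P P.K) (theta13OfThm1CCMWZB F N j γ εbg ε₀ ε₂₉ B₃ B₃' a₀ a₁ Efl logz).τ9.M i).Dom) (z : Site (F.P P.K) i) (g' : ℝ),
      Continuous (fun U : GaugeField (F.P P.K) 0 (SU N) =>
        ((σ P k (chainWitness _ P (σ P) k).1 (chainWitness _ P (σ P) k).2).1 s).E i X z g'
          (Sect2.ofBackgroundC (settingOfRecord₁₃ F N (theta13OfThm1CCMWZB F N j γ εbg ε₀ ε₂₉ B₃ B₃' a₀ a₁ Efl logz) P).ι U)))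
    (hCE : ∀ P : B12.RunParams, Step.InInterval γ' P.K (gOfRecord₁₃ F N (theta13OfThm1CCMWZB F N j γ εbg ε₀ ε₂₉ B₃ B₃' a₀ a₁ Efl logz) P) →
      ∀ (k : ℕ) (s : SeqOfRecord F (theta13OfThm1CCMWZB F N j γ εbg ε₀ ε₂₉ B₃ B₃' a₀ a₁ Efl logz).ν (theta13OfThm1CCMWZB F N j γ εbg ε₀ ε₂₉ B₃ B₃' a₀ a₁ Efl logz).τ9.M
        (gOfRecord₁₃ F N (theta13OfThm1CCMWZB F N j γ εbg ε₀ ε₂₉ B₃ B₃' a₀ a₁ Efl logz) P) P.K (k + 1)) (i : ℕ), 1 ≤ i → ∃ CE : ℝ,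
      ∀ (X : (Sect2.domSys (F.P P.K) (theta13OfThm1CCMWZB F N j γ εbg ε₀ ε₂₉ B₃ B₃' a₀ a₁ Efl logz).τ9.M i).Dom) (z : Site (F.P P.K) i) (g' : ℝ) (U : GaugeField (F.P P.K) 0 (SU N)),
      |(((σ P k (chainWitness _ P (σ P) k).1 (chainWitness _ P (σ P) k).2).1 s).E i X z g'
          (Sect2.ofBackgroundC (settingOfRecord₁₃ F N (theta13OfThm1CCMWZB F N j γ εbg ε₀ ε₂₉ B₃ B₃' a₀ a₁ Efl logz) P).ι U)).re| ≤ CE)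
    (hR : ∀ P : B12.RunParams, Step.InInterval γ' P.K (gOfRecord₁₃ F N (theta13OfThm1CCMWZB F N j γ εbg ε₀ ε₂₉ B₃ B₃' a₀ a₁ Efl logz) P) →
      ∀ (k : ℕ) (s : SeqOfRecord F (theta13OfThm1CCMWZB F N j γ εbg ε₀ ε₂₉ B₃ B₃' a₀ a₁ Efl logz).ν (theta13OfThm1CCMWZB F N j γ εbg ε₀ ε₂₉ B₃ B₃' a₀ a₁ Efl logz).τ9.M
        (gOfRecord₁₃ F N (theta13OfThm1CCMWZB F N j γ εbg ε₀ ε₂₉ B₃ B₃' a₀ a₁ Efl logz) P) P.K (k + 1)) (i : ℕ), 1 ≤ i →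
      ∀ X : (Sect2.domSys (F.P P.K) (theta13OfThm1CCMWZB F N j γ εbg ε₀ ε₂₉ B₃ B₃' a₀ a₁ Efl logz).τ9.M i).Dom,
      Continuous (fun U : GaugeField (F.P P.K) 0 (SU N) =>
        ((σ P k (chainWitness _ P (σ P) k).1 (chainWitness _ P (σ P) k).2).1 s).R i X
          (Sect2.ofBackgroundC (settingOfRecord₁₃ F N (theta13OfThm1CCMWZB F N j γ εbg ε₀ ε₂₉ B₃ B₃' a₀ a₁ Efl logz) P).ι U)))
    (hB9 : ∀ P : B12.RunParams, Step.InInterval γ' P.K (gOfRecord₁₃ F N (theta13OfThm1CCMWZB F N j γ εbg ε₀ ε₂₉ B₃ B₃' a₀ a₁ Efl logz) P) →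
      ∀ (k : ℕ) (s : SeqOfRecord F (theta13OfThm1CCMWZB F N j γ εbg ε₀ ε₂₉ B₃ B₃' a₀ a₁ Efl logz).ν (theta13OfThm1CCMWZB F N j γ εbg ε₀ ε₂₉ B₃ B₃' a₀ a₁ Efl logz).τ9.M
        (gOfRecord₁₃ F N (theta13OfThm1CCMWZB F N j γ εbg ε₀ ε₂₉ B₃ B₃' a₀ a₁ Efl logz) P) P.K (k + 1)) (S' : ℕ → Set (Site (F.P P.K) 0)) (i : ℕ)
        (X : (Sect2.domSys (F.P P.K) (theta13OfThm1CCMWZB F N j γ εbg ε₀ ε₂₉ B₃ B₃' a₀ a₁ Efl logz).τ9.M i).Dom),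
      Continuous (fun q : GaugeField (F.P P.K) 0 (SU N) × MSFluct (F.P P.K) (FluctV N) =>
        ((σ P k (chainWitness _ P (σ P) k).1 (chainWitness _ P (σ P) k).2).1 s).B i X
          (Sect2.ofBackgroundC (settingOfRecord₁₃ F N (theta13OfThm1CCMWZB F N j γ εbg ε₀ ε₂₉ B₃ B₃' a₀ a₁ Efl logz) P).ι q.1) (S', q.2)))
    (hCB : ∀ P : B12.RunParams, Step.InInterval γ' P.K (gOfRecord₁₃ F N (theta13OfThm1CCMWZB F N j γ εbg ε₀ ε₂₉ B₃ B₃' a₀ a₁ Efl logz) P) →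
      ∀ (k : ℕ) (s : SeqOfRecord F (theta13OfThm1CCMWZB F N j γ εbg ε₀ ε₂₉ B₃ B₃' a₀ a₁ Efl logz).ν (theta13OfThm1CCMWZB F N j γ εbg ε₀ ε₂₉ B₃ B₃' a₀ a₁ Efl logz).τ9.M
        (gOfRecord₁₃ F N (theta13OfThm1CCMWZB F N j γ εbg ε₀ ε₂₉ B₃ B₃' a₀ a₁ Efl logz) P) P.K (k + 1)) (i : ℕ), 1 ≤ i → ∃ CB : ℝ,
      ∀ (X : (Sect2.domSys (F.P P.K) (theta13OfThm1CCMWZB F N j γ εbg ε₀ ε₂₉ B₃ B₃' a₀ a₁ Efl logz).τ9.M i).Dom) (U : GaugeField (F.P P.K) 0 (SU N)) (a : Tk.SFluct (F.P P.K) (FluctV N)),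
      |(((σ P k (chainWitness _ P (σ P) k).1 (chainWitness _ P (σ P) k).2).1 s).B i X
          (Sect2.ofBackgroundC (settingOfRecord₁₃ F N (theta13OfThm1CCMWZB F N j γ εbg ε₀ ε₂₉ B₃ B₃' a₀ a₁ Efl logz) P).ι U) a).re| ≤ CB)
    (w : WorldP) (hC : w.C = (datumOfRecord₁₃CoPH F N (gaussPinH (Stage13HParams.ofHistoryBlind F N ⟨theta13OfThm1CCMWZB F N j γ εbg ε₀ ε₂₉ B₃ B₃' a₀ a₁ Efl logz, Zr⟩)) hrec).C)
    (hγw : w.γ ≤ γ') : ∀ P : B12.RunParams, Dag.B14_main (leavesP w P) :=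
  b14_main_leavesP_all_theta13OfThm1CCMWZBH_of_supplyChainAt_family (θ := gaussPinH (Stage13HParams.ofHistoryBlind F N ⟨theta13OfThm1CCMWZB F N j γ εbg ε₀ ε₂₉ B₃ B₃' a₀ a₁ Efl logz, Zr⟩))
    rfl hγ₀ hγh hbg hε hε' hB hB' ha₀ ha₁ hrec
    (supplyChainAt_family_of_gaussCert_of_continuous (gaussPinH (Stage13HParams.ofHistoryBlind F N ⟨theta13OfThm1CCMWZB F N j γ εbg ε₀ ε₂₉ B₃ B₃' a₀ a₁ Efl logz, Zr⟩))
      (gaussPinH_ζ0 _) (gaussPinH_quad _) hrec (by show 1 ≤ F.L ^ j; exact Nat.one_le_pow _ _ (by have := F.hL11; omega)) σ hσ hE hCE hR hB9 hCB) w hC hγw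

/-- **★★★ N11's CHILD FAMILY IN dag-n24-c's `h11` SHAPE AT `θᴳᶻ`'s SepCoPH DATUM ON THE OPERAND-ROWS ROAD, WINDOWED** — g4 FILE 4 §4 at the z-witness: per windowed run
[III] §3's supplier at `θᴳᶻ` with `SupplierObligations` and def-T's `OperandRowsAlongChain` (`supplyChainAt_family_of_gaussCert_of_operandRows` at the certificate, keys `rfl`);
any door proof `hG`; window `0 < γ ≤ ½` + six signs; letters NOT read; `γ₁₁ := γ′`. [cite: Balaban1988Convergent, Theorem p.245, Thm 1 p.262, remark p.262, p.244 L36–38, §3 p.279, (3.16)–(3.25) pp.268–270, (2.21) p.258, (1.15) p.249; Balaban1989LargeFieldII, Thm 1 + (0.1) pp.355–356, (0.15) p.360; Balaban1987RG1, Thm 1 p.259; Balaban1989LargeFieldI, (0.2)–(0.4) p.176] -/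
theorem h11Family_gaussPinH_ofHistoryBlind_theta13OfThm1CCMWZB_of_operandRows_windowed (hγ₀ : 0 < γ) (hγh : γ ≤ 1 / 2) (hbg : 0 < εbg) (hε : 0 < ε₀) (hε' : 0 < ε₂₉)
    (hB : 0 ≤ B₃) (hB' : 0 ≤ B₃') (ha₀ : 0 < a₀) (ha₁ : 0 < a₁)
    (hG : (gaussPinH (Stage13HParams.ofHistoryBlind F N ⟨theta13OfThm1CCMWZB F N j γ εbg ε₀ ε₂₉ B₃ B₃' a₀ a₁ Efl logz, Zr⟩)).Provisos₁₃SepCoPH F N) {γ' : ℝ} (hγ' : 0 < γ')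
    (σ : (P : B12.RunParams) → Sect3Supplier (gaussPinH (Stage13HParams.ofHistoryBlind F N ⟨theta13OfThm1CCMWZB F N j γ εbg ε₀ ε₂₉ B₃ B₃' a₀ a₁ Efl logz, Zr⟩)) P)
    (hσ : ∀ P : B12.RunParams, Step.InInterval γ' P.K (gOfRecord₁₃ F N (theta13OfThm1CCMWZB F N j γ εbg ε₀ ε₂₉ B₃ B₃' a₀ a₁ Efl logz) P) →
      SupplierObligations (gaussPinH (Stage13HParams.ofHistoryBlind F N ⟨theta13OfThm1CCMWZB F N j γ εbg ε₀ ε₂₉ B₃ B₃' a₀ a₁ Efl logz, Zr⟩)) P (σ P))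
    (hops : ∀ P : B12.RunParams, Step.InInterval γ' P.K (gOfRecord₁₃ F N (theta13OfThm1CCMWZB F N j γ εbg ε₀ ε₂₉ B₃ B₃' a₀ a₁ Efl logz) P) →
      OperandRowsAlongChain (gaussPinH (Stage13HParams.ofHistoryBlind F N ⟨theta13OfThm1CCMWZB F N j γ εbg ε₀ ε₂₉ B₃ B₃' a₀ a₁ Efl logz, Zr⟩)) P (σ P)) :
    ∀ βup β₀ : ℝ, ∃ γ₁₁ : ℝ, 0 < γ₁₁ ∧ ∀ w : WorldP,
      w.C = (datumOfRecord₁₃SepCoPH F N (gaussPinH (Stage13HParams.ofHistoryBlind F N ⟨theta13OfThm1CCMWZB F N j γ εbg ε₀ ε₂₉ B₃ B₃' a₀ a₁ Efl logz, Zr⟩)) hG).C →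
      w.βup = βup → w.β₀ = β₀ → w.γ ≤ γ₁₁ → ∀ P : B12.RunParams, (leavesP w P).b7 → (leavesP w P).b8 → (leavesP w P).b9 → (leavesP w P).b10 → (leavesP w P).b11 →
      (leavesP w P).smallCouplings → (leavesP w P).smallFieldInductive → (leavesP w P).flowControl →
        ∀ k, k < P.K → SLaw₁₃CoPH F N (gaussPinH (Stage13HParams.ofHistoryBlind F N ⟨theta13OfThm1CCMWZB F N j γ εbg ε₀ ε₂₉ B₃ B₃' a₀ a₁ Efl logz, Zr⟩)) P k →
          TLaw₁₃CoPH F N (gaussPinH (Stage13HParams.ofHistoryBlind F N ⟨theta13OfThm1CCMWZB F N j γ εbg ε₀ ε₂₉ B₃ B₃' a₀ a₁ Efl logz, Zr⟩)) P k :=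
  h11Family_gaussPinH_ofHistoryBlind_theta13OfThm1CCMWZB_of_supplyChainAt_family Zr hγ₀ hγh hbg hε hε' hB hB' ha₀ ha₁ hG hγ'
    (supplyChainAt_family_of_gaussCert_of_operandRows (gaussPinH (Stage13HParams.ofHistoryBlind F N ⟨theta13OfThm1CCMWZB F N j γ εbg ε₀ ε₂₉ B₃ B₃' a₀ a₁ Efl logz, Zr⟩))
      (gaussPinH_ζ0 _) (gaussPinH_quad _) hG.toCore (by show 1 ≤ F.L ^ j; exact Nat.one_le_pow _ _ (by have := F.hL11; omega)) σ hσ hops)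

end CertificateZ

/-! ## §4  Bridge (`rfl`): the Z certificate `θᴳᶻ` IS the `εbg = 1` member of the Z3 family of certificates -/

section Bridge

variable (j : ℕ) (γ ε₀ ε₂₉ B₃ B₃' a₀ a₁ : ℝ) (Efl logz : B12.RunParams → ℕ → ℝ) (Zr : (q : B12.RunParams) → TkResidualW F N (FluctV N) q.K)

/-- **BRIDGE (`rfl`): `θᴳᶻ(…; Efl, logz) = θᴳᶻᴮ(…; εbg := 1; Efl, logz)`** — the certificate of the z-witness is the certificate of the Z3 member at background radius `1` (Z3's
`theta13OfThm1CCMWZ_eq_B` under `gaussPinH ∘ ofHistoryBlind`); so dag-n11-w1's `…AtZWitness` §3 theorems are the `εbg = 1` instances of §3. [cite: Balaban1989LargeFieldI, (0.3) p.176; Balaban1987RG1, (0.21) p.256; Balaban1988Convergent, (3.16) p.268 (bookkeeping)] -/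
theorem gaussPinH_ofHistoryBlind_theta13OfThm1CCMWZ_eq_B_one :
    gaussPinH (Stage13HParams.ofHistoryBlind F N ⟨theta13OfThm1CCMWZ F N j γ ε₀ ε₂₉ B₃ B₃' a₀ a₁ Efl logz, Zr⟩) =
      gaussPinH (Stage13HParams.ofHistoryBlind F N ⟨theta13OfThm1CCMWZB F N j γ 1 ε₀ ε₂₉ B₃ B₃' a₀ a₁ Efl logz, Zr⟩) := rfl

end Bridge

end Summit.QuantumFields.YangMills.Theorems.BalabanUVNodesN11NodeFacesOfSupplyChainTokensAtZBWitness

end
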